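import Literature.AlgebraicGeometry.HodgeTheory.MonodromySemisimpleSubvariations
import HarnessLib

/-!
# A reducible sub-variation contains a proper sub-variation (relative Lemma E; Deligne 1987, Prop. 1.13)

Family `hodge`, layer `Literature/AlgebraicGeometry/HodgeTheory`; a PROVED corollary file (no named
fact) on top of `MonodromySemisimpleSubvariations.lean`, requested 2026-08-29 by the planner of route
`HodgeConjecture/Q8SymplecticPowers` (memo `ROUTE-P3v28-g37.md` §7 (C33), «relative LEMMA E … ASKED of
lit as a PROVED corollary») for the one-member criteria STAB-TOP / BURNSIDE-TOP for the stub S4 of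
crux K1Q: there the carrier is not all of `Hᵏ(X_s(ℂ); ℂ)` but an `H`-stable complex SUB-VARIATION
`M ⊆ Hᵏ(X_s(ℂ); ℂ)` (an eigenspace `ker(τ* − i)` of a flat automorphism), and one needs: *if `M` is
`H`-reducible then `M` contains an `H`-stable sub-variation `K` with `0 ≠ K ≠ M`*. The sibling file
proves this for `M = ⊤` (`….exists_proper_subvariation_of_reducible`); here is the relative form, from
the same named fact FACT B `deligne1987_monodromy_directSum_irreducible_subvariations` (Deligne 1987
Prop. 1.13 (ii) with (1.12.1): `Hᵏ(X_s(ℂ); ℂ) = ⊕_α S_α`, `S_α` `H`-stable `H`-irreducible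
sub-variations, `H ≤ π₁(S(ℂ), s)` of finite index).

Printed argument followed (memo (C33), LEMMA): the projections `pr_α` of the decomposition are
`H`-equivariant and respect Hodge types at every point, so `K_α := M ∩ ⊕_{β ≠ α} S_β = ker(pr_α|_M)` is
an `H`-stable sub-variation of `M`; if some `K_α ∉ {0, M}` we are done; otherwise pick `α` with
`pr_α|_M ≠ 0`: then `K_α = 0`, `pr_α|_M : M ↪ S_α` is an injective `H`-map onto a non-zero `H`-stable
subspace of the irreducible `S_α`, so `M ≅ S_α` is `H`-irreducible — contradiction.

## Contents (all PROVED; vocabulary of the sibling file)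

* Linear algebra for an internal direct sum `V = ⊕ T_i` of stable irreducible subspaces under a
  family of endomorphisms `g a`, `a ∈ A` (`IsStableUnder`, `IsIrreducibleUnder`, `internalProj`):
  `IsStableUnder.internalProj_comm` (the projections are equivariant), `….eraseSup_le_ker_internalProj`
  / `….mem_eraseSup_of_internalProj_eq_zero` (`ker pr_i = ⊕_{j ≠ i} T_j`),
  `….isIrreducibleUnder_of_forall_inf_eraseSup` (if every `M ∩ ⊕_{j ≠ i} T_j` is `0` or `M`, a
  non-zero `M` is irreducible).
* `IsSubvariation.inf` (intersections of sub-variations are sub-variations; transports are injective).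
* `deligne1987_monodromy_directSum_irreducible_subvariations.exists_proper_subvariation_of_reducible_le`
  — the relative Lemma E — and its contrapositive
  `….isTransportIrreducible_of_forall_subvariation_eq` (an `H`-stable sub-variation `M ≠ 0` whose only
  `H`-stable sub-variations are `0` and `M` is `H`-irreducible), the shape used in (C33).
* (appended) `IsStableUnder.exists_finsetSup_isCompl_of_isInternal` (complements can be taken to be
  partial sums of the decomposition) and `….exists_isCompl_subvariation` /
  `….exists_isCompl_subvariation_le`: from FACT B alone, every `H`-stable `M` has an `H`-stable
  complement (globally, or inside an `H`-stable sub-variation `N ≥ M`) which is itself a complex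
  SUB-VARIATION — the flat splittings `Hᵏ = M ⊕ M'`, `N = M ⊕ M''` consumed by the cell's (C44).

## References
* [Deligne1987] P. Deligne, Un théorème de finitude pour la monodromie, in: Discrete Groups in Geometry
  and Analysis, Progr. Math. 67 (1987) 1–19: §1.12, (1.12.1), Prop. 1.13 (held:
  book:howe1987-discrete-groups-geometry-analysis, chunks p0010–p0011).
-/

noncomputable section

open CategoryTheory AlgebraicGeometry
open _root_.Topology
open Literature.AlgebraicTopology.SingularHomology Literature.AlgebraicGeometry.Motives

namespace Literature.AlgebraicGeometry.HodgeTheory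

section HodgeTheory

/-! ### Linear algebra: projections of a direct sum of stable irreducible subspaces -/

section LinearAlgebra

variable {K : Type*} [Field K] {V : Type*} [AddCommGroup V] [Module K V] {α : Type*}
  {g : α → V →ₗ[K] V} {A : Set α} {ι : Type*} [Fintype ι] [DecidableEq ι] {T : ι → Submodule K V}

namespace IsStableUnder

/-- **The projections of an internal direct sum of stable subspaces are equivariant**:
`g a ∘ pr_i = pr_i ∘ g a` for `a ∈ A`. [cite: Deligne1987, §1.12 and (1.12.1) (p. 10)] -/
theorem internalProj_comm (hT : DirectSum.IsInternal T) (hTs : ∀ i, IsStableUnder g A (T i))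
    {a : α} (ha : a ∈ A) (i : ι) (x : V) :
    g a (internalProj hT i x) = internalProj hT i (g a x) :=
  map_internalProj hT (g a).toAddMonoidHom (fun j y hy ↦ hTs j a ha y hy) i x

/-- `⊕_{j ≠ i} T_j ≤ ker pr_i`. [cite: Deligne1987, (1.12.1) (p. 10)] -/
theorem eraseSup_le_ker_internalProj (hT : DirectSum.IsInternal T) (i : ι) :
    (Finset.univ.erase i).sup T ≤ LinearMap.ker (internalProj hT i) :=
  Finset.sup_le fun _ hj _ hx ↦
    LinearMap.mem_ker.2 (internalProj_apply_of_mem_ne hT (Finset.ne_of_mem_erase hj) hx)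

/-- `ker pr_i ≤ ⊕_{j ≠ i} T_j` (`x = ∑_j pr_j x`). [cite: Deligne1987, (1.12.1) (p. 10)] -/
theorem mem_eraseSup_of_internalProj_eq_zero (hT : DirectSum.IsInternal T) {i : ι} {x : V}
    (hx : internalProj hT i x = 0) : x ∈ (Finset.univ.erase i).sup T := by
  rw [← sum_internalProj hT x, ← Finset.sum_erase_add _ _ (Finset.mem_univ i), hx, add_zero]
  exact Submodule.sum_mem _ fun j hj ↦ Finset.le_sup (f := T) hj (internalProj_mem hT j x)

/-- The image `pr_i(W)` of a stable subspace is stable (equivariance). [cite: Deligne1987, §1.12 (p. 10)] -/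
theorem map_internalProj_of_isStableUnder (hT : DirectSum.IsInternal T)
    (hTs : ∀ i, IsStableUnder g A (T i)) (i : ι) {W : Submodule K V} (hW : IsStableUnder g A W) :
    IsStableUnder g A (W.map (internalProj hT i)) := by
  rintro a ha _ ⟨w, hw, rfl⟩
  exact ⟨g a w, hW a ha w hw, (internalProj_comm hT hTs ha i w).symm⟩

/-- **Irreducibility criterion.** Let `V = ⊕_i T_i` be an internal direct sum of stable irreducible
subspaces and `M ≠ 0` a subspace such that, for every `i`, `M ∩ ⊕_{j ≠ i} T_j` is `0` or all of `M`.
Then `M` is irreducible (its only stable subspaces are `0` and `M`): for `i` with `pr_i|_M ≠ 0` the map `pr_i|_M` is injective and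
equivariant onto a non-zero stable subspace of the irreducible `T_i`, so every non-zero stable
`W ≤ M` has `pr_i(W) = T_i = pr_i(M)` and `W = M`. [cite: Deligne1987, §1.12 and Prop. 1.13 (p. 10–11)] -/
theorem isIrreducibleUnder_of_forall_inf_eraseSup (hT : DirectSum.IsInternal T)
    (hTs : ∀ i, IsStableUnder g A (T i)) (hTi : ∀ i, IsIrreducibleUnder g A (T i))
    {M : Submodule K V} (hM0 : M ≠ ⊥)
    (hK : ∀ i, M ⊓ (Finset.univ.erase i).sup T = ⊥ ∨ M ≤ (Finset.univ.erase i).sup T) :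
    IsIrreducibleUnder g A M := by
  -- an index `i` with `pr_i|_M ≠ 0`
  obtain ⟨m, hmM, hm0⟩ := (Submodule.ne_bot_iff M).1 hM0
  obtain ⟨i, hi⟩ : ∃ i, internalProj hT i m ≠ 0 := by
    by_contra h
    push Not at h
    exact hm0 (by rw [← sum_internalProj hT m]; exact Finset.sum_eq_zero fun j _ ↦ h j)
  have hMle : ¬M ≤ (Finset.univ.erase i).sup T := fun hle ↦
    hi (LinearMap.mem_ker.1 (eraseSup_le_ker_internalProj hT i (hle hmM)))
  have hKi : M ⊓ (Finset.univ.erase i).sup T = ⊥ := (hK i).resolve_right hMle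
  -- `pr_i` is injective on `M`
  have hinj : ∀ x ∈ M, internalProj hT i x = 0 → x = 0 := fun x hxM hx ↦
    (Submodule.mem_bot K).1 (hKi ▸ ⟨hxM, mem_eraseSup_of_internalProj_eq_zero hT hx⟩)
  refine ⟨hM0, fun W hWM hWs ↦ ?_⟩
  rcases eq_or_ne W ⊥ with hW0 | hW0
  · exact Or.inl hW0
  right
  -- `pr_i(W)` is a non-zero stable subspace of the irreducible `T_i`, hence `= T_i`
  have hWi : W.map (internalProj hT i) = T i := by
    rcases (hTi i).2 _ (Submodule.map_le_iff_le_comap.2 fun w _ ↦ internalProj_mem hT i w)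
      (map_internalProj_of_isStableUnder hT hTs i hWs) with h | h
    · exfalso
      obtain ⟨w, hwW, hw0⟩ := (Submodule.ne_bot_iff W).1 hW0
      exact hw0 (hinj w (hWM hwW) ((Submodule.mem_bot K).1 (h ▸ Submodule.mem_map_of_mem hwW)))
    · exact h
  refine le_antisymm hWM fun x hxM ↦ ?_
  obtain ⟨w, hwW, hwx⟩ : internalProj hT i x ∈ W.map (internalProj hT i) :=
    hWi ▸ internalProj_mem hT i x
  have hxw : x - w = 0 :=
    hinj (x - w) (Submodule.sub_mem _ hxM (hWM hwW)) (by rw [map_sub, hwx, sub_self])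
  rw [sub_eq_zero] at hxw
  exact hxw ▸ hwW

/-- **Complements inside a direct sum of stable irreducibles can be taken to be partial sums**: for
`V = ⊕_i T_i` an internal direct sum of stable irreducible subspaces and `W` stable, there is a set of
indices `J` with `W ⊕ (⊕_{j ∈ J} T_j) = V` (take `J` maximal with `W ∩ ⊕_J T_j = 0`; the proof of
`exists_isCompl_of_isInternal` in the sibling file, with the complement made explicit).
[cite: Deligne1987, §1.12 and (1.12.1) (p. 10)] -/
theorem exists_finsetSup_isCompl_of_isInternal (hT : DirectSum.IsInternal T)
    (hTs : ∀ i, IsStableUnder g A (T i)) (hTi : ∀ i, IsIrreducibleUnder g A (T i))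
    {W : Submodule K V} (hW : IsStableUnder g A W) :
    ∃ J : Finset ι, IsCompl W (J.sup T) := by
  classical
  set S : Finset (Finset ι) := Finset.univ.filter (fun J ↦ Disjoint W (J.sup T)) with hS
  have hSne : S.Nonempty := ⟨∅, by simp [hS]⟩
  obtain ⟨J, hJS, hJmax⟩ := S.exists_max_image Finset.card hSne
  have hJ : Disjoint W (J.sup T) := (Finset.mem_filter.1 hJS).2
  have hJst : IsStableUnder g A (J.sup T) := IsStableUnder.finsetSup J T fun i _ ↦ hTs i
  refine ⟨J, hJ, ?_⟩
  rw [codisjoint_iff, eq_top_iff, ← hT.submodule_iSup_eq_top, iSup_le_iff]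
  intro i
  by_contra hi
  have hst : IsStableUnder g A (T i ⊓ (W ⊔ J.sup T)) := (hTs i).inf (hW.sup hJst)
  rcases (hTi i).2 _ inf_le_left hst with h0 | h1
  · have hd : Disjoint (W ⊔ J.sup T) (T i) := by
      rw [disjoint_iff, inf_comm, h0]
    have hd' : Disjoint W (J.sup T ⊔ T i) := hJ.disjoint_sup_right_of_disjoint_sup_left hd
    have hiJ : i ∉ J := fun hiJ ↦ hi ((Finset.le_sup hiJ).trans le_sup_right)
    have hmem : insert i J ∈ S := by
      rw [hS, Finset.mem_filter]
      refine ⟨Finset.mem_univ _, ?_⟩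
      rw [Finset.sup_insert, sup_comm]
      exact hd'
    have hcard := hJmax _ hmem
    rw [Finset.card_insert_of_notMem hiJ] at hcard
    omega
  · exact hi (h1 ▸ inf_le_right)

end IsStableUnder

end LinearAlgebra

/-! ### Intersections of sub-variations -/

section Family

variable {𝒳 S : SchemeOver ℂ} {f : 𝒳 ⟶ S} {k : ℕ} {U : Set (ComplexPoints S)}
  {hU : IsCohomologicallyLocallyTrivialOn f U}

/-- Transport along a path class is injective (it is inverted by transport along the reverse path).
[cite: VoisinHodgeI2002, §9.2.1] -/
theorem transportLinear_injective {s t : U} (γ : Path.Homotopic.Quotient s t) :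
    Function.Injective (transportLinear f k hU γ) :=
  Function.LeftInverse.injective fun a ↦ transportFun_symm_transportFun f k hU γ a

/-- **The intersection of two sub-variations is a sub-variation** (all fibres smooth projective of
dimension `n`): transports are injective, so the transport of `W ⊓ W'` is the intersection of the
transports, and Hodge subspaces are closed under `⊓`. [cite: Deligne1987, §1.1 and Prop. 1.13 (p. 10–11)] -/
theorem IsSubvariation.inf {n : ℕ} (hf : ∀ t : U, IsSmoothProjective n (fiberOver f t.1)) {s : U}
    {W W' : Submodule ℂ (complexBetti (fiberOver f s.1) k)} (hW : IsSubvariation f k hU n s W)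
    (hW' : IsSubvariation f k hU n s W') : IsSubvariation f k hU n s (W ⊓ W') := by
  intro t γ
  rw [Submodule.map_inf _ (transportLinear_injective γ)]
  exact (hW t γ).inf (hf t) (hW' t γ)

end Family

/-! ### The relative Lemma E -/

namespace deligne1987_monodromy_directSum_irreducible_subvariations

variable {𝒳 S : SchemeOver ℂ} {f : 𝒳 ⟶ S} {n k : ℕ} {s : (Set.univ : Set (ComplexPoints S))}
  {H : Subgroup (FundamentalGroup (Set.univ : Set (ComplexPoints S)) s)}

/-- **Relative LEMMA E** (memo (C33); from FACT B = Deligne 1987 Prop. 1.13 (ii) with (1.12.1)). Let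
`M ⊆ Hᵏ(X_s(ℂ); ℂ)` be an `H`-stable complex sub-variation (`H ≤ π₁(S(ℂ), s)` of finite index, `f`
smooth projective over a smooth quasi-projective `S`). If `M` is `H`-REDUCIBLE (contains an `H`-stable
`W` with `0 ≠ W ≠ M`) then `M` contains an `H`-stable SUB-VARIATION `K` with `0 ≠ K ≠ M` — namely
some `K_α = M ∩ ⊕_{β ≠ α} S_β` for the decomposition `Hᵏ = ⊕_α S_α` of FACT B.
[cite: Deligne1987, (1.12.1) and Prop. 1.13 (p. 10–11)] -/
theorem exists_proper_subvariation_of_reducible_le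
    (h : deligne1987_monodromy_directSum_irreducible_subvariations)
    (hf : IsSmoothProjectiveFamily f n) (hq : IsQuasiProjectiveOver S) (hS : Smooth S.hom)
    (hU : IsCohomologicallyLocallyTrivialOn f (Set.univ : Set (ComplexPoints S))) (hH : H.FiniteIndex)
    {M : Submodule ℂ (complexBetti (fiberOver f s.1) k)}
    (hMs : IsTransportStable f k hU s H M) (hMv : IsSubvariation f k hU n s M)
    (hred : ∃ W : Submodule ℂ (complexBetti (fiberOver f s.1) k),
      W ≤ M ∧ IsTransportStable f k hU s H W ∧ W ≠ ⊥ ∧ W ≠ M) :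
    ∃ K : Submodule ℂ (complexBetti (fiberOver f s.1) k),
      K ≤ M ∧ IsTransportStable f k hU s H K ∧ IsSubvariation f k hU n s K ∧ K ≠ ⊥ ∧ K ≠ M := by
  classical
  obtain ⟨m, T, hT, hTP⟩ := h f n k hf hq hS hU s H hH
  obtain ⟨W, hWM, hWs, hW0, hWM'⟩ := hred
  have hf' : ∀ t : (Set.univ : Set (ComplexPoints S)), IsSmoothProjective n (fiberOver f t.1) :=
    fun t ↦ hf.isSmoothProjective t.1
  by_contra hK
  push Not at hK
  -- every `K_i = M ∩ ⊕_{j ≠ i} T_j` is an `H`-stable sub-variation of `M`, hence `0` or `M`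
  have hdich : ∀ i, M ⊓ (Finset.univ.erase i).sup T = ⊥ ∨ M ≤ (Finset.univ.erase i).sup T := by
    intro i
    rcases eq_or_ne (M ⊓ (Finset.univ.erase i).sup T) ⊥ with h0 | h0
    · exact Or.inl h0
    · refine Or.inr (inf_eq_left.1 (hK _ inf_le_left ?_ ?_ h0))
      · exact IsStableUnder.inf hMs (IsStableUnder.finsetSup _ T fun j _ ↦ (hTP j).1)
      · exact hMv.inf hf' (IsSubvariation.finsetSup hf' _ T fun j _ ↦ (hTP j).2.2)
  have hirr : IsTransportIrreducible f k hU s H M :=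
    IsStableUnder.isIrreducibleUnder_of_forall_inf_eraseSup hT (fun i ↦ (hTP i).1)
      (fun i ↦ (hTP i).2.1) (fun hM0 ↦ hW0 (eq_bot_iff.2 (hM0 ▸ hWM))) hdich
  rcases hirr.2 W hWM hWs with h0 | h1
  · exact hW0 h0
  · exact hWM' h1

/-- **Contrapositive, the shape used by STAB-TOP / BURNSIDE-TOP (memo (C33))**: an `H`-stable
sub-variation `M ≠ 0` whose only `H`-stable sub-variations are `0` and `M` is `H`-IRREDUCIBLE.
[cite: Deligne1987, (1.12.1) and Prop. 1.13 (p. 10–11)] -/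
theorem isTransportIrreducible_of_forall_subvariation_eq
    (h : deligne1987_monodromy_directSum_irreducible_subvariations)
    (hf : IsSmoothProjectiveFamily f n) (hq : IsQuasiProjectiveOver S) (hS : Smooth S.hom)
    (hU : IsCohomologicallyLocallyTrivialOn f (Set.univ : Set (ComplexPoints S))) (hH : H.FiniteIndex)
    {M : Submodule ℂ (complexBetti (fiberOver f s.1) k)}
    (hMs : IsTransportStable f k hU s H M) (hMv : IsSubvariation f k hU n s M) (hM0 : M ≠ ⊥)
    (hno : ∀ K : Submodule ℂ (complexBetti (fiberOver f s.1) k), K ≤ M →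
      IsTransportStable f k hU s H K → IsSubvariation f k hU n s K → K = ⊥ ∨ K = M) :
    IsTransportIrreducible f k hU s H M := by
  refine ⟨hM0, fun W hWM hWs ↦ ?_⟩
  by_contra hW
  push Not at hW
  obtain ⟨K, hKM, hKs, hKv, hK0, hKM'⟩ :=
    exists_proper_subvariation_of_reducible_le h hf hq hS hU hH hMs hMv ⟨W, hWM, hWs, hW.1, hW.2⟩
  rcases hno K hKM hKs hKv with h0 | h1
  · exact hK0 h0
  · exact hKM' h1

/-- **Complements can be taken to be sub-variations** (from FACT B alone — no polarisation needed):
every `H`-stable `M ⊆ Hᵏ(X_s(ℂ); ℂ)` has a complement `M'` which is `H`-stable AND a complex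
sub-variation, namely a partial sum `⊕_{α ∈ J} S_α` of the decomposition `Hᵏ = ⊕_α S_α` of FACT B
(this is how Deligne 1987 §1.12 reads «facteur direct»). Consumed by the flat-splitting arguments of
the cell ((C44): `M = K ⊕ K'` inside `Hᵏ = M ⊕ M'` with all pieces sub-variations).
[cite: Deligne1987, §1.12, (1.12.1) and Prop. 1.13 (p. 10–11)] -/
theorem exists_isCompl_subvariation
    (h : deligne1987_monodromy_directSum_irreducible_subvariations)
    (hf : IsSmoothProjectiveFamily f n) (hq : IsQuasiProjectiveOver S) (hS : Smooth S.hom)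
    (hU : IsCohomologicallyLocallyTrivialOn f (Set.univ : Set (ComplexPoints S))) (hH : H.FiniteIndex)
    {M : Submodule ℂ (complexBetti (fiberOver f s.1) k)} (hMs : IsTransportStable f k hU s H M) :
    ∃ M' : Submodule ℂ (complexBetti (fiberOver f s.1) k),
      IsCompl M M' ∧ IsTransportStable f k hU s H M' ∧ IsSubvariation f k hU n s M' := by
  classical
  obtain ⟨m, T, hT, hTP⟩ := h f n k hf hq hS hU s H hH
  obtain ⟨J, hJ⟩ := IsStableUnder.exists_finsetSup_isCompl_of_isInternal hT (fun i ↦ (hTP i).1)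
    (fun i ↦ (hTP i).2.1) hMs
  exact ⟨J.sup T, hJ, IsStableUnder.finsetSup J T fun i _ ↦ (hTP i).1,
    IsSubvariation.finsetSup (fun t ↦ hf.isSmoothProjective t.1) J T fun i _ ↦ (hTP i).2.2⟩

/-- **A sub-variation `M` and a complementary sub-variation, both `H`-stable, with `M ⊕ M' = ⊤`** —
the relative version for an `H`-stable `M ≤ N` inside an `H`-stable `N`: `M` has an `H`-stable
sub-variation complement `M''` INSIDE `N` (`M ⊕ M'' = N`), namely `N ⊓ M'` for a global complement
`M'` as above (modularity), when `N` is itself a sub-variation.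
[cite: Deligne1987, §1.12, (1.12.1) and Prop. 1.13 (p. 10–11)] -/
theorem exists_isCompl_subvariation_le
    (h : deligne1987_monodromy_directSum_irreducible_subvariations)
    (hf : IsSmoothProjectiveFamily f n) (hq : IsQuasiProjectiveOver S) (hS : Smooth S.hom)
    (hU : IsCohomologicallyLocallyTrivialOn f (Set.univ : Set (ComplexPoints S))) (hH : H.FiniteIndex)
    {M N : Submodule ℂ (complexBetti (fiberOver f s.1) k)} (hMN : M ≤ N)
    (hMs : IsTransportStable f k hU s H M) (hNs : IsTransportStable f k hU s H N)
    (hNv : IsSubvariation f k hU n s N) :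
    ∃ M'' : Submodule ℂ (complexBetti (fiberOver f s.1) k), M'' ≤ N ∧ Disjoint M M'' ∧ M ⊔ M'' = N ∧
      IsTransportStable f k hU s H M'' ∧ IsSubvariation f k hU n s M'' := by
  obtain ⟨M', hc, hM's, hM'v⟩ := exists_isCompl_subvariation h hf hq hS hU hH hMs
  refine ⟨N ⊓ M', inf_le_left, hc.disjoint.mono_right inf_le_right, ?_, IsStableUnder.inf hNs hM's,
    hNv.inf (fun t ↦ hf.isSmoothProjective t.1) hM'v⟩
  rw [inf_comm, ← sup_inf_assoc_of_le M' hMN, hc.sup_eq_top, top_inf_eq]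

end deligne1987_monodromy_directSum_irreducible_subvariations

end HodgeTheory

end Literature.AlgebraicGeometry.HodgeTheory

end
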